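import Summits.AtomisticToContinuum.BoseEinsteinCondensation.Theorems.BECTangentRigidityRigidMomentumBoundSmearingReduction
import Summits.AtomisticToContinuum.BoseEinsteinCondensation.Theorems.BECTangentRigidityRigidMomentumBoundStubDirichletEnergyLinear
import Summits.AtomisticToContinuum.BoseEinsteinCondensation.Theorems.BECTangentRigidityRigidMomentumBoundStubSlopeChain
import Summits.AtomisticToContinuum.BoseEinsteinCondensation.Theorems.BECTangentRigidityRigidMomentumBoundStubShrinkBound
import Summits.AtomisticToContinuum.BoseEinsteinCondensation.Theorems.BECTangentRigidityRigidMomentumBoundStubBoxEnergyRightContinuous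
import Summits.AtomisticToContinuum.BoseEinsteinCondensation.Theorems.BECTangentRigidityRigidMomentumBoundStubNearWallEnergy
import Literature.MathematicalPhysics.QuantumManyBody.BoseGasThermodynamicLimitProofs
import Literature.MathematicalPhysics.QuantumManyBody.BoseGasDirichletWall
import HarnessLib

/-!
# `RigidMomentumBound` (crux of route `BECTangentRigidity`), line `registered` — the closing file

`theorem RigidMomentumBound_proof : Summit.AtomisticToContinuum.BoseEinsteinCondensation.Theses.BECTangentRigidity.RigidMomentumBound`.

Composition of the line (every piece landed under `Theorems/BECTangentRigidityRigidMomentumBound*.lean`):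
König's decomposition and the rigid-smearing bound reduce the crux to **displacement softness**
`E₀(N, L_N) ≤ E₀(N, (1+κ/N)L_N) + εN/L_N²` (`Smearing.rigidMomentumBound_of_displacementSoftness`);
displacement softness follows from Hadamard's variational formula rendered variationally: the
shrink bound R1 (`stub_shrinkBound`), right-continuity of `L ↦ E₀(N,L)` R2
(`stub_boxEnergyRightContinuous`), the chaining lemma R4 (`stub_slopeChain`), the linear energy bound S1
(`stub_dirichletEnergyLinear`) and the near-wall energy bound R3 (`stub_nearWallEnergy`: the wall
flux is `o(N)`, proved along minimising sequences by the local virial identity for one-coordinate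
marginals, Sturm comparison, the insertion bound and slab non-concentration).
-/

noncomputable section

namespace Summit.AtomisticToContinuum.BoseEinsteinCondensation.Theorems

open MeasureTheory Filter Set
open scoped ENNReal NNReal BigOperators Topology
open Literature.MathematicalPhysics.QuantumManyBody.BoseGas
open Summit.AtomisticToContinuum.BoseEinsteinCondensation.Theses.BECTangentRigidity
open Summit.AtomisticToContinuum.BoseEinsteinCondensation.Theorems.RigidMomentumBound

namespace RigidMomentumBound

/-! ## Assembly A — displacement softness S4 from R1–R4 and S1 (sorry-free) -/

/-- Elementary real-arithmetic step of the assembly: from `X (1 - 4 w³ B₀) ≤ E + 101 B₀ w` with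
`0 ≤ X`, `0 ≤ E`, `0 < B₀`, `0 < w ≤ 1`, `4 w E ≤ 51`, `816 w B₀ ≤ 52` conclude `X ≤ E + 204 B₀ w`. -/
theorem slope_arith {X E B₀ w : ℝ} (hB₀ : 0 < B₀) (hw : 0 < w) (hw1 : w ≤ 1)
    (hwE : 4 * w * E ≤ 51) (hwB : 816 * w * B₀ ≤ 52)
    (h : X * (1 - 4 * w ^ 3 * B₀) ≤ E + 101 * B₀ * w) : X ≤ E + 204 * B₀ * w := by
  have hw2 : w ^ 2 ≤ w := by nlinarith
  have hw3 : w ^ 3 ≤ w := by nlinarith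
  have hc : 4 * w ^ 3 * B₀ ≤ 52 / 204 := by nlinarith
  have hpos : 0 < 1 - 4 * w ^ 3 * B₀ := by linarith
  -- it suffices that `E + 101 B₀ w ≤ (E + 204 B₀ w)(1 - 4w³B₀)`
  have key : E + 101 * B₀ * w ≤ (E + 204 * B₀ * w) * (1 - 4 * w ^ 3 * B₀) := by
    have h1 : 4 * w ^ 3 * B₀ * E ≤ 51 * B₀ * w := by
      have : 4 * w ^ 3 * B₀ * E = (4 * w * E) * (w ^ 2) * B₀ := by ring
      rw [this]
      have : (4 * w * E) * w ^ 2 * B₀ ≤ 51 * w ^ 2 * B₀ := by gcongr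
      nlinarith [mul_pos hB₀ hw]
    have h2 : 204 * B₀ * w * (4 * w ^ 3 * B₀) ≤ 52 * B₀ * w := by
      have : 204 * B₀ * w * (4 * w ^ 3 * B₀) = (816 * w * B₀) * w ^ 2 * (B₀ * w) := by ring
      rw [this]
      have : (816 * w * B₀) * w ^ 2 * (B₀ * w) ≤ 52 * w ^ 2 * (B₀ * w) := by
        gcongr
      nlinarith [mul_pos hB₀ hw]
    nlinarith
  by_contra hlt
  rw [not_le] at hlt
  have : (E + 204 * B₀ * w) * (1 - 4 * w ^ 3 * B₀) < X * (1 - 4 * w ^ 3 * B₀) :=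
    mul_lt_mul_of_pos_right hlt hpos
  linarith

/-- **S4 `stub_displacementSoftness`, DERIVED** (was the open stub of v3/v4): for every repulsive
finite-range `v`, at all small `ρ`, for all `ε, κ > 0`, eventually in `N`,
`E₀(N, L_N) ≤ E₀(N, (1 + κ/N)·L_N) + ε N/L_N²`. Proof: with `g(t) = E₀(N,t)` (finite on `[L_N, ∞)` by S1 and
monotonicity) apply `stub_slopeChain` on `[L_N, (1+κ/N)L_N]` with slope `B = εN²/(κL_N³)`: the right
no-jump hypothesis is `stub_boxEnergyRightContinuous`; the left-increment hypothesis is `stub_shrinkBound`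
fed with the near-minimisers of `stub_nearWallEnergy` (at `ε/204`), after clearing the normalisation factor
`1 - 4w³B₀ ≥ 150/204` (`slope_arith`); finally `B·(κL_N/N) = εN/L_N²`. -/
theorem displacementSoftness :
    ∀ v : ℝ → ℝ≥0∞, IsRepulsiveFiniteRange v → ∃ ρ₀ : ℝ, 0 < ρ₀ ∧ ∀ ρ : ℝ, 0 < ρ → ρ < ρ₀ →
      ∀ ε : ℝ, 0 < ε → ∀ κ : ℝ, 0 < κ → ∀ᶠ N : ℕ in atTop,
        groundStateEnergy v N (sideLength ρ N) ≤
          groundStateEnergy v N ((1 + κ / N) * sideLength ρ N) +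
            ENNReal.ofReal (ε * N / sideLength ρ N ^ 2) := by
  intro v hv
  obtain ⟨ρ₁, hρ₁, h₁⟩ := stub_dirichletEnergyLinear v hv
  obtain ⟨ρ₅, hρ₅, h₅⟩ := stub_nearWallEnergy v hv
  refine ⟨min ρ₁ ρ₅, lt_min hρ₁ hρ₅, fun ρ hρ hρlt ε hε κ hκ => ?_⟩
  obtain ⟨C, _, hE₀⟩ := h₁ ρ hρ (hρlt.trans_le (min_le_left _ _))
  have hW := h₅ ρ hρ (hρlt.trans_le (min_le_right _ _)) (ε / 204) (by positivity) κ hκ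
  filter_upwards [hE₀, hW, eventually_gt_atTop 0] with N hN₁ hN₅ hN0
  have hNpos : (0 : ℝ) < N := Nat.cast_pos.2 hN0
  set L : ℝ := sideLength ρ N with hLdef
  have hLpos : 0 < L := sideLength_pos_of_pos hρ hN0
  set Lp : ℝ := (1 + κ / N) * L with hLpdef
  have hκN : 0 < κ / N := div_pos hκ hNpos
  have hLLp : L ≤ Lp := by
    rw [hLpdef]; nlinarith
  -- finiteness of `E₀(N, t)` for `t ≥ L`
  have hfin : ∀ t : ℝ, L ≤ t → groundStateEnergy v N t ≠ ⊤ := fun t ht =>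
    ne_top_of_le_ne_top ENNReal.ofReal_ne_top ((groundStateEnergy_anti v N ht).trans hN₁)
  -- the real-valued energy and the slope
  set g : ℝ → ℝ := fun t => (groundStateEnergy v N t).toReal with hgdef
  set B₀ : ℝ := ε / 204 * N ^ 2 / (κ * L ^ 3) with hB₀def
  have hB₀ : 0 < B₀ := by positivity
  set B : ℝ := 204 * B₀ with hBdef
  have hB : 0 ≤ B := by positivity
  -- hypothesis 1 of the chain: no downward jump to the right (R2)
  have hright : ∀ t ∈ Set.Ico L Lp, ∀ η : ℝ, 0 < η → ∃ w₀ : ℝ, 0 < w₀ ∧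
      ∀ w : ℝ, 0 < w → w < w₀ → t + w ≤ Lp → g t ≤ g (t + w) + η := by
    intro t ht η hη
    obtain ⟨w₀, hw₀, hw⟩ :=
      stub_boxEnergyRightContinuous v hv N t (hLpos.trans_le ht.1) (hfin t ht.1) η hη
    refine ⟨w₀, hw₀, fun w hw0 hww _ => ?_⟩
    have h := hw w hw0 hww
    have ht1 : groundStateEnergy v N (t + w) ≠ ⊤ := hfin (t + w) (by linarith [ht.1])
    have h2 : (groundStateEnergy v N t).toReal ≤
        (groundStateEnergy v N (t + w) + ENNReal.ofReal η).toReal :=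
      ENNReal.toReal_mono (ENNReal.add_ne_top.2 ⟨ht1, ENNReal.ofReal_ne_top⟩) h
    rw [ENNReal.toReal_add ht1 ENNReal.ofReal_ne_top, ENNReal.toReal_ofReal hη.le] at h2
    exact h2
  -- hypothesis 2 of the chain: left increments `≤ B w` (R1 + R3)
  have hslope : ∀ t ∈ Set.Ioc L Lp, ∃ w₀ : ℝ, 0 < w₀ ∧
      ∀ w : ℝ, 0 < w → w ≤ w₀ → L ≤ t - w → g (t - w) ≤ g t + B * w := by
    intro t ht
    have htpos : 0 < t := hLpos.trans ht.1
    obtain ⟨w₀, hw₀, hw⟩ := hN₅ t ⟨ht.1.le, ht.2⟩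
    set Et : ℝ := g t with hEtdef
    have hEt : 0 ≤ Et := ENNReal.toReal_nonneg
    refine ⟨min w₀ (min (t / 4) (min 1 (min (51 / (4 * Et + 1)) (52 / (816 * B₀ + 1))))),
      by positivity, fun w hw0 hwle hLtw => ?_⟩
    have hww₀ : w ≤ w₀ := hwle.trans (min_le_left _ _)
    have hwt : w ≤ t / 4 := hwle.trans ((min_le_right _ _).trans (min_le_left _ _))
    have hw1 : w ≤ 1 :=
      hwle.trans ((min_le_right _ _).trans ((min_le_right _ _).trans (min_le_left _ _)))
    have hw51 : w ≤ 51 / (4 * Et + 1) :=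
      hwle.trans ((min_le_right _ _).trans ((min_le_right _ _).trans
        ((min_le_right _ _).trans (min_le_left _ _))))
    have hw52 : w ≤ 52 / (816 * B₀ + 1) :=
      hwle.trans ((min_le_right _ _).trans ((min_le_right _ _).trans
        ((min_le_right _ _).trans (min_le_right _ _))))
    have hwE : 4 * w * Et ≤ 51 := by
      have h1 : w * (4 * Et + 1) ≤ 51 := by
        rwa [le_div_iff₀ (by positivity)] at hw51
      nlinarith
    have hwB : 816 * w * B₀ ≤ 52 := by
      have h1 : w * (816 * B₀ + 1) ≤ 52 := by
        rwa [le_div_iff₀ (by positivity)] at hw52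
      nlinarith
    obtain ⟨u, huE, hu𝓔⟩ := hw w ⟨hw0, hww₀⟩
    have h2w : 2 * w < t := by linarith
    have hsb := stub_shrinkBound v hv.1 hw0 h2w u
    -- abbreviations
    set 𝓔 : ℝ≥0∞ := ∑ j : Fin N, ∑ a : Fin 3, ∫⁻ X in {X : Config N | t - 2 * w < X j a},
        (kineticDensity u.ψ X + interaction v X * (‖u.ψ X‖₊ : ℝ≥0∞) ^ 2) with h𝓔def
    set b : ℝ≥0∞ := ENNReal.ofReal (ε / 204 * N ^ 2 * w / (κ * sideLength ρ N ^ 3)) with hbdef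
    have hbw : b = ENNReal.ofReal (B₀ * w) := by
      rw [hbdef, hB₀def]; congr 1; ring
    set X : ℝ≥0∞ := groundStateEnergy v N (t - w) with hXdef
    have hXtop : X ≠ ⊤ := hfin (t - w) hLtw
    have hEtop : groundStateEnergy v N t ≠ ⊤ := hfin t ht.1.le
    -- `X (1 - ofReal(4w²) b) ≤ E₀ t + 101 b`
    have hc_le : ENNReal.ofReal (4 * w ^ 2) * 𝓔 ≤ ENNReal.ofReal (4 * w ^ 2) * b := by gcongr
    have h1 : X * (1 - ENNReal.ofReal (4 * w ^ 2) * b) ≤ groundStateEnergy v N t + 101 * b :=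
      calc X * (1 - ENNReal.ofReal (4 * w ^ 2) * b)
          ≤ X * (1 - ENNReal.ofReal (4 * w ^ 2) * 𝓔) := by
            gcongr
        _ ≤ energy v u + 100 * 𝓔 := hsb
        _ ≤ (groundStateEnergy v N t + b) + 100 * b := by gcongr
        _ = groundStateEnergy v N t + 101 * b := by ring
    -- the correction factor as a real number
    have hcw : ENNReal.ofReal (4 * w ^ 2) * b = ENNReal.ofReal (4 * w ^ 3 * B₀) := by
      rw [hbw, ← ENNReal.ofReal_mul (by positivity)]; congr 1; ring
    have hc1 : 4 * w ^ 3 * B₀ ≤ 1 := by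
      have hw3 : w ^ 3 ≤ w := pow_le_of_le_one hw0.le hw1 three_ne_zero
      have : w ^ 3 * B₀ ≤ w * B₀ := mul_le_mul_of_nonneg_right hw3 hB₀.le
      nlinarith
    rw [hcw] at h1
    have hsub : (1 - ENNReal.ofReal (4 * w ^ 3 * B₀) : ℝ≥0∞) =
        ENNReal.ofReal (1 - 4 * w ^ 3 * B₀) := by
      rw [ENNReal.ofReal_sub _ (by positivity), ENNReal.ofReal_one]
    rw [hsub] at h1
    -- pass to reals
    have hRtop : groundStateEnergy v N t + 101 * b ≠ ⊤ := by
      rw [hbw]; exact ENNReal.add_ne_top.2 ⟨hEtop, ENNReal.mul_ne_top (by norm_num) ENNReal.ofReal_ne_top⟩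
    have h2 := ENNReal.toReal_mono hRtop h1
    rw [ENNReal.toReal_mul, ENNReal.toReal_ofReal (by linarith), ENNReal.toReal_add hEtop
      (by rw [hbw]; exact ENNReal.mul_ne_top (by norm_num) ENNReal.ofReal_ne_top),
      ENNReal.toReal_mul, hbw, ENNReal.toReal_ofReal (by positivity)] at h2
    have h3 : X.toReal * (1 - 4 * w ^ 3 * B₀) ≤ Et + 101 * B₀ * w := by
      have : ((101 : ℝ≥0∞)).toReal = 101 := by norm_num
      rw [this] at h2
      linarith
    have h4 := slope_arith hB₀ hw0 hw1 hwE hwB h3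
    -- `g (t - w) = X.toReal`, `B w = 204 B₀ w`
    show X.toReal ≤ Et + B * w
    rw [hBdef]; linarith
  -- the chain
  have key := stub_slopeChain g L Lp B hLLp hB hright hslope
  -- `B (Lp - L) = ε N / L²`
  have hBL : B * (Lp - L) = ε * N / L ^ 2 := by
    rw [hBdef, hB₀def, hLpdef]
    field_simp
    ring
  rw [hBL] at key
  -- back to `ℝ≥0∞`
  have hLtop : groundStateEnergy v N L ≠ ⊤ := hfin L le_rfl
  have hLptop : groundStateEnergy v N Lp ≠ ⊤ := hfin Lp hLLp
  calc groundStateEnergy v N L = ENNReal.ofReal (g L) := (ENNReal.ofReal_toReal hLtop).symm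
    _ ≤ ENNReal.ofReal (g Lp + ε * N / L ^ 2) := ENNReal.ofReal_le_ofReal key
    _ = groundStateEnergy v N Lp + ENNReal.ofReal (ε * N / L ^ 2) := by
        rw [ENNReal.ofReal_add ENNReal.toReal_nonneg (by positivity), ENNReal.ofReal_toReal hLptop]

end RigidMomentumBound

/-- **The crux `RigidMomentumBound` of route `BECTangentRigidity`**: for every repulsive finite-range
pair potential, at small density, near-minimisers of the Dirichlet energy in the thermodynamic box have
total-momentum fluctuation `∑ₐ ‖P_a Ψ‖² ≤ ε N²/L_N²` eventually — König + rigid smearing + displacement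
softness (`RigidMomentumBound.displacementSoftness`). -/
theorem RigidMomentumBound_proof :
    Summit.AtomisticToContinuum.BoseEinsteinCondensation.Theses.BECTangentRigidity.RigidMomentumBound :=
  Smearing.rigidMomentumBound_of_displacementSoftness RigidMomentumBound.displacementSoftness

end Summit.AtomisticToContinuum.BoseEinsteinCondensation.Theorems

end
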